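import Summits.CriticalPhenomena.SAWScalingLimit.Theses.SAWDefectDecoherence
import Summits.CriticalPhenomena.SAWScalingLimit.Theorems.DefectDecoherence.Negative.WallExitTwoPoint
import Literature.Probability.RandomPlanarGeometry.HexDomainSingleton
import Literature.Probability.LatticeModels.TriangularLatticeProofs
import HarnessLib

/-!
# Route `SAWDefectDecoherence`, support `SpinShift` (stmt-CriticalPhenomena-8514): the exact
spin-shift identity of the hexagonal SAW parafermionic observable

For a boundary root `a = {u, w}` (`u ∉ Λ ∋ w`, `u ∼ w`), any edge `{v, t}` of `ℍ`, every fugacity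
`x` and spin `σ`:
`(c_t − c_v)² · F_{x,σ}({v,t}) = (c_w − c_u)² · F_{x,σ−2}({v,t})`.

Proof (walk by walk).  For a polyline `z₀, z₁, …, z_m` with non-degenerate segments the unit
tangent telescopes: `e^{iW} · (z₁ − z₀)/|z₁ − z₀| = (z_m − z_{m−1})/|z_m − z_{m−1}|`, because at
each interior point `e^{i·arg(d'/d)} = (d'/|d'|)/(d/|d|)` (`exp_winding_mul_I_mul_unit`).  For a
walk `γ : a → {v,t}` the first increment is `(c_w − c_u)/2` (the walk starts at `w` since
`u ∉ Λ`), the last one is `±(c_t − c_v)/2`, and both have length `1/(2√3)` (adjacent centres of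
`ℍ` are `1/√3` apart, `normSq_hexCenter_sub_of_adj` of the tree); squaring kills the sign:
`e^{2iW}(c_w − c_u)² = (c_t − c_v)²` (`exp_two_winding_mul_sq`), whence
`(c_w − c_u)² e^{−i(σ−2)W} x^ℓ = (c_t − c_v)² e^{−iσW} x^ℓ`; sum over `γ`.
Source of the statement: Duminil-Copin–Smirnov 2012 (arXiv:1007.0575), §2 ("the complex weight
… can be interpreted as a product of terms `λ` or `λ̄` per left or right turn"), an elementary
by-product; the identity itself is route bookkeeping (the per-edge aliasing `|F_{σ−2}| = |F_σ|`).
-/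

namespace Summit.CriticalPhenomena.SAWScalingLimit.Theorems.SpinShift

open Literature.Probability.LatticeModels Literature.Probability.RandomPlanarGeometry.SAW
open Summit.CriticalPhenomena.SAWScalingLimit.Cruxes.DefectDecoherence.TipMartingaleDepthInduction
  (WallExitTwoPoint.normSq_hexCenter_sub_of_adj)

noncomputable section

/-! ### Lattice geometry: adjacent centres are `1/√3` apart

The squared edge length `normSq (c_g − c_f) = 1/3` of the embedded honeycomb lattice is already in
the tree (`WallExitTwoPoint.normSq_hexCenter_sub_of_adj`, imported, used by its full name); we only
derive the two consequences used below. -/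

/-- Adjacent vertices of the hexagonal lattice have distinct centres. [folklore] -/
theorem hexCenter_sub_ne_zero_of_adj {f g : HexVertex} (h : hexGraph.Adj f g) :
    hexCenter g - hexCenter f ≠ 0 := by
  intro h0
  have := WallExitTwoPoint.normSq_hexCenter_sub_of_adj h
  rw [h0, map_zero] at this
  norm_num at this

/-- All edges of the embedded hexagonal lattice have the same length. [folklore] -/
theorem norm_hexCenter_sub_eq_of_adj {f g f' g' : HexVertex} (h : hexGraph.Adj f g)
    (h' : hexGraph.Adj f' g') :
    ‖hexCenter g - hexCenter f‖ = ‖hexCenter g' - hexCenter f'‖ := by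
  rw [← sq_eq_sq₀ (norm_nonneg _) (norm_nonneg _), Complex.sq_norm, Complex.sq_norm,
    WallExitTwoPoint.normSq_hexCenter_sub_of_adj h, WallExitTwoPoint.normSq_hexCenter_sub_of_adj h']

/-! ### Telescoping of the unit tangent along a polyline -/

/-- At one corner: `e^{i·arg(d₂/d₁)} · d₁/|d₁| = d₂/|d₂|` for non-zero increments. [folklore] -/
theorem exp_arg_div_mul_I_mul_unit {d₁ d₂ : ℂ} (h₁ : d₁ ≠ 0) (h₂ : d₂ ≠ 0) :
    Complex.exp ((Complex.arg (d₂ / d₁) : ℂ) * Complex.I) * (d₁ / (‖d₁‖ : ℂ)) =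
      d₂ / (‖d₂‖ : ℂ) := by
  have key := Complex.norm_mul_exp_arg_mul_I (d₂ / d₁)
  have hn₁ : (‖d₁‖ : ℂ) ≠ 0 := by exact_mod_cast norm_ne_zero_iff.2 h₁
  have hn₂ : (‖d₂‖ : ℂ) ≠ 0 := by exact_mod_cast norm_ne_zero_iff.2 h₂
  have hq : (‖d₂ / d₁‖ : ℂ) ≠ 0 := by exact_mod_cast norm_ne_zero_iff.2 (div_ne_zero h₂ h₁)
  have e : Complex.exp ((Complex.arg (d₂ / d₁) : ℂ) * Complex.I) =
      d₂ / d₁ / (‖d₂ / d₁‖ : ℂ) := by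
    rw [eq_div_iff hq, mul_comm]
    exact key
  rw [e, norm_div, Complex.ofReal_div]
  field_simp

/-- **The unit tangent telescopes**: for a polyline `z₁, z₂, …` (written both as
`z₁ :: z₂ :: zs` and as `ys ++ [q, p]`) with pairwise distinct consecutive points,
`e^{iW} · (z₂ − z₁)/|z₂ − z₁| = (p − q)/|p − q|`, `W` its winding (sum of turning angles).
[folklore] -/
theorem exp_winding_mul_I_mul_unit (zs : List ℂ) : ∀ (z₁ z₂ : ℂ) (ys : List ℂ) (q p : ℂ),
    ys ++ [q, p] = z₁ :: z₂ :: zs → List.IsChain (· ≠ ·) (z₁ :: z₂ :: zs) →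
    Complex.exp ((winding (z₁ :: z₂ :: zs) : ℂ) * Complex.I) * ((z₂ - z₁) / (‖z₂ - z₁‖ : ℂ)) =
      (p - q) / (‖p - q‖ : ℂ) := by
  induction zs with
  | nil =>
    intro z₁ z₂ ys q p hys _
    have hnil : ys = [] := by
      rcases ys with _ | ⟨y, _ | ⟨y', ys⟩⟩
      · rfl
      · simp at hys
      · simp at hys
    subst hnil
    simp only [List.nil_append, List.cons.injEq, and_true] at hys
    obtain ⟨rfl, rfl⟩ := hys
    simp
  | cons z₃ zs ih =>
    intro z₁ z₂ ys q p hys hch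
    obtain ⟨y, ys', rfl⟩ : ∃ y ys', ys = y :: ys' := by
      rcases ys with _ | ⟨y, ys'⟩
      · simp at hys
      · exact ⟨y, ys', rfl⟩
    simp only [List.cons_append, List.cons.injEq] at hys
    obtain ⟨-, hys'⟩ := hys
    rw [List.isChain_cons_cons] at hch
    obtain ⟨h12, hch'⟩ := hch
    have h23 : z₂ ≠ z₃ := (List.isChain_cons_cons.1 hch').1
    rw [winding_cons_cons_cons, Complex.ofReal_add, add_mul, Complex.exp_add]
    calc Complex.exp ((turning z₁ z₂ z₃ : ℂ) * Complex.I) *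
          Complex.exp ((winding (z₂ :: z₃ :: zs) : ℂ) * Complex.I) * ((z₂ - z₁) / (‖z₂ - z₁‖ : ℂ))
        = Complex.exp ((winding (z₂ :: z₃ :: zs) : ℂ) * Complex.I) *
            (Complex.exp ((Complex.arg ((z₃ - z₂) / (z₂ - z₁)) : ℂ) * Complex.I) *
              ((z₂ - z₁) / (‖z₂ - z₁‖ : ℂ))) := by rw [turning]; ring
      _ = Complex.exp ((winding (z₂ :: z₃ :: zs) : ℂ) * Complex.I) *
            ((z₃ - z₂) / (‖z₃ - z₂‖ : ℂ)) := by
          rw [exp_arg_div_mul_I_mul_unit (sub_ne_zero.2 h12.symm) (sub_ne_zero.2 h23.symm)]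
      _ = (p - q) / (‖p - q‖ : ℂ) := ih z₂ z₃ ys' q p hys' hch'

/-! ### The per-walk identity -/

/-- **Per-walk spin shift**: for a self-avoiding walk `γ` from the boundary mid-edge `{u, w}`
(`u ∉ Λ`, `u ∼ w`) to the mid-edge `{v, t}` (`v ∼ t`), `e^{2iW(γ)} (c_w − c_u)² = (c_t − c_v)²`:
the unit tangent telescopes from the first half-edge `(c_w − c_u)/2` to the last one
`±(c_t − c_v)/2`, and squaring removes the sign. [folklore] -/
theorem exp_two_winding_mul_sq {Λ : Finset HexVertex} {u w v t : HexVertex}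
    (huw : hexGraph.Adj u w) (hu : u ∉ Λ) (hvt : hexGraph.Adj v t)
    (γ : HexMidEdgeSAW Λ s(u, w) s(v, t)) :
    Complex.exp (2 * (γ.winding : ℂ) * Complex.I) * (hexCenter w - hexCenter u) ^ 2 =
      (hexCenter t - hexCenter v) ^ 2 := by
  by_cases hnil : γ.verts = []
  · -- the trivial walk: `{u, w} = {v, t}`, no winding
    have hW : γ.winding = 0 := by
      simp [HexMidEdgeSAW.winding, HexMidEdgeSAW.points, hnil]
    rw [hW, Complex.ofReal_zero, mul_zero, zero_mul, Complex.exp_zero, one_mul]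
    rcases Sym2.eq_iff.1 (γ.eq_of_nil hnil) with ⟨rfl, rfl⟩ | ⟨rfl, rfl⟩ <;> ring
  · -- a genuine walk `w = v₁, …, vₙ = g`
    -- the first vertex is `w`
    obtain ⟨w₁, rest, hrest⟩ := List.exists_cons_of_ne_nil hnil
    have hw₁ : w₁ = w := by
      have h := γ.head_mem w₁ (by rw [hrest]; rfl)
      rcases Sym2.mem_iff.1 h with rfl | h
      · exact absurd (γ.subset _ (by rw [hrest]; exact List.mem_cons_self)) hu
      · exact h
    subst hw₁
    -- the last vertex `g ∈ {v, t}`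
    obtain ⟨init, g, hinit⟩ : ∃ init g, γ.verts = init ++ [g] :=
      ⟨_, _, (List.dropLast_append_getLast hnil).symm⟩
    have hg : g ∈ s(v, t) := γ.getLast_mem g (by rw [hinit]; simp)
    -- the two end increments
    set D₁ : ℂ := hexCenter w₁ - hexCenter u with hD₁
    set D₂ : ℂ := hexCenter t - hexCenter v with hD₂
    have hD₁0 : D₁ ≠ 0 := hexCenter_sub_ne_zero_of_adj huw
    have hD₂0 : D₂ ≠ 0 := hexCenter_sub_ne_zero_of_adj hvt
    have hnorm : ‖D₁‖ = ‖D₂‖ := norm_hexCenter_sub_eq_of_adj huw hvt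
    have e₁ : hexCenter w₁ - hexMidpoint s(u, w₁) = D₁ / 2 := by
      rw [hexMidpoint_mk, hD₁]; ring
    have e₂ : hexMidpoint s(v, t) - hexCenter g = D₂ / 2 ∨
        hexMidpoint s(v, t) - hexCenter g = -(D₂ / 2) := by
      rcases Sym2.mem_iff.1 hg with rfl | rfl
      · left; rw [hexMidpoint_mk, hD₂]; ring
      · right; rw [hexMidpoint_mk, hD₂]; ring
    -- the polyline, written from both ends
    have hp1 : γ.points = hexMidpoint s(u, w₁) :: hexCenter w₁ ::
        (rest.map hexCenter ++ [hexMidpoint s(v, t)]) := by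
      simp [HexMidEdgeSAW.points, hrest]
    have hp2 : (hexMidpoint s(u, w₁) :: init.map hexCenter) ++ [hexCenter g, hexMidpoint s(v, t)] =
        γ.points := by
      simp [HexMidEdgeSAW.points, hinit, List.map_append, List.append_assoc]
    -- consecutive points are distinct
    have hch0 : List.IsChain (· ≠ ·) (γ.verts.map hexCenter) :=
      List.isChain_map_of_isChain hexCenter
        (fun a b hab => (sub_ne_zero.1 (hexCenter_sub_ne_zero_of_adj hab)).symm) γ.isChain
    have hch1 : List.IsChain (· ≠ ·) (hexMidpoint s(u, w₁) :: γ.verts.map hexCenter) := by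
      rw [hrest, List.map_cons, List.isChain_cons_cons]
      refine ⟨?_, by rw [← List.map_cons, ← hrest]; exact hch0⟩
      intro h
      apply hD₁0
      have h' : hexCenter w₁ - hexMidpoint s(u, w₁) = 0 := by rw [h, sub_self]
      rw [e₁] at h'
      simpa using h'
    have hch : List.IsChain (· ≠ ·)
        ((hexMidpoint s(u, w₁) :: init.map hexCenter) ++ [hexCenter g, hexMidpoint s(v, t)]) := by
      rw [List.isChain_append_cons_cons]
      refine ⟨?_, ?_, List.isChain_singleton _⟩
      · have e : (hexMidpoint s(u, w₁) :: init.map hexCenter) ++ [hexCenter g] =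
            hexMidpoint s(u, w₁) :: γ.verts.map hexCenter := by
          rw [hinit, List.map_append, List.map_cons, List.map_nil, List.cons_append]
        rw [e]
        exact hch1
      · intro h
        apply hD₂0
        have h' : hexMidpoint s(v, t) - hexCenter g = 0 := by rw [h, sub_self]
        rcases e₂ with e | e <;> rw [e] at h' <;> simpa using h'
    -- telescope
    have key := exp_winding_mul_I_mul_unit (rest.map hexCenter ++ [hexMidpoint s(v, t)])
      (hexMidpoint s(u, w₁)) (hexCenter w₁) (hexMidpoint s(u, w₁) :: init.map hexCenter)
      (hexCenter g) (hexMidpoint s(v, t)) (hp2.trans hp1) (by rw [← hp1, ← hp2]; exact hch)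
    rw [← hp1] at key
    change Complex.exp ((γ.winding : ℂ) * Complex.I) * _ = _ at key
    rw [e₁] at key
    -- `e^{iW} D₁ = ± D₂`
    have hn0 : (‖D₂‖ : ℂ) ≠ 0 := by exact_mod_cast norm_ne_zero_iff.2 hD₂0
    have hlin : Complex.exp ((γ.winding : ℂ) * Complex.I) * D₁ = D₂ ∨
        Complex.exp ((γ.winding : ℂ) * Complex.I) * D₁ = -D₂ := by
      rcases e₂ with e | e
      · left
        rw [e, norm_div, norm_div, hnorm] at key
        simp only [RCLike.norm_ofNat, Complex.ofReal_div, Complex.ofReal_ofNat] at key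
        field_simp at key
        linear_combination key
      · right
        rw [e, norm_neg, norm_div, norm_div, hnorm] at key
        simp only [RCLike.norm_ofNat, Complex.ofReal_div, Complex.ofReal_ofNat] at key
        field_simp at key
        linear_combination key
    have hsq : (Complex.exp ((γ.winding : ℂ) * Complex.I) * D₁) ^ 2 = D₂ ^ 2 := by
      rcases hlin with h | h
      · rw [h]
      · rw [h]; ring
    calc Complex.exp (2 * (γ.winding : ℂ) * Complex.I) * D₁ ^ 2
        = (Complex.exp ((γ.winding : ℂ) * Complex.I) * D₁) ^ 2 := by
          rw [mul_pow, ← Complex.exp_nat_mul]; ring_nf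
      _ = D₂ ^ 2 := hsq

/-- **Per-walk spin shift for the weights**: `(c_t − c_v)² e^{−iσW} x^ℓ = (c_w − c_u)² e^{−i(σ−2)W} x^ℓ`.
[folklore] -/
theorem sq_mul_weight_eq {Λ : Finset HexVertex} {u w v t : HexVertex}
    (huw : hexGraph.Adj u w) (hu : u ∉ Λ) (hvt : hexGraph.Adj v t)
    (γ : HexMidEdgeSAW Λ s(u, w) s(v, t)) (x σ : ℝ) :
    (hexCenter t - hexCenter v) ^ 2 * γ.weight x σ =
      (hexCenter w - hexCenter u) ^ 2 * γ.weight x (σ - 2) := by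
  rw [← exp_two_winding_mul_sq huw hu hvt γ, HexMidEdgeSAW.weight,
    HexMidEdgeSAW.weight]
  have : Complex.exp (-Complex.I * ((σ - 2 : ℝ) : ℂ) * (γ.winding : ℂ)) =
      Complex.exp (2 * (γ.winding : ℂ) * Complex.I) *
        Complex.exp (-Complex.I * (σ : ℂ) * (γ.winding : ℂ)) := by
    rw [← Complex.exp_add]; congr 1; push_cast; ring
  rw [this]; ring

/-! ### The route decl -/

/-- **`SpinShift`** (route `SAWDefectDecoherence`, support item stmt-CriticalPhenomena-8514):
for a boundary root `a = {u, w}` (`u ∼ w`, `u ∉ Λ ∋ w`), any edge `{v, t}` of `ℍ`, every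
fugacity `x` and spin `σ`,
`(c_t − c_v)² · F_{x,σ}(Λ, a, {v,t}) = (c_w − c_u)² · F_{x,σ−2}(Λ, a, {v,t})` — summed from the
per-walk identity `sq_mul_weight_eq`. [folklore] -/
theorem spinShift_proof : Summit.CriticalPhenomena.SAWScalingLimit.Theses.SAWDefectDecoherence.SpinShift := by
  intro Λ u w huw hu _hw v t hvt x σ
  rw [hexParafermionicObservable, hexParafermionicObservable, Finset.mul_sum, Finset.mul_sum]
  exact Finset.sum_congr rfl fun γ _ => sq_mul_weight_eq huw hu hvt γ x σ

end

end Summit.CriticalPhenomena.SAWScalingLimit.Theorems.SpinShift
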